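import Literature.NumberTheory.GaloisRepresentations.GaloisCohomologyKummerProofs
import HarnessLib

/-!
# [AbsTopIII] Cor. 1.10 (i)(a), levels: the factorial chain of the modules `μ_{(i+1)!}(k̄)`

Level data for presenting the Galois cyclotome `μ_Ẑ(G_k)` ([AbsTopIII] Cor. 1.10 (i)(a) p. 41–42,
lit key `paper:url-5493eb38cbb7`; tree `muZhat`/`galCyclotomeTopRep`) as an inverse limit of FINITE
discrete Galois modules (sequel `GaloisCyclotomeTower.lean`): the cofinal factorial chain
`cycLevel i = (i+1)!` of `ℕ+`, the power maps `muPowHom : μ_N(k̄) → μ_n(k̄)` (`n d = N`, `ζ ↦ ζ^d`)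
between the tree's discrete Galois modules `DiscreteGaloisModule.mu k n` — SURJECTIVE since `k̄` is
algebraically closed — and the extension of a chain-compatible family of roots of unity
(`s_{i+1}^{i+2} = s_i`) to all levels `n ∈ ℕ+` (`cycLiftUnit`, `cycLiftTorsion`), independent of the
auxiliary index (`IsChainCompatible.pow_div_eq_pow_div`).  Pure bookkeeping on roots of unity of an
algebraically closed field (any base field `k`).

HONEST FRAMING: classical, undisputed material; nothing here bears on [IUTchIII] Cor. 3.12.

## References
* [MochizukiAbsTopIII2015] S. Mochizuki, *Topics in Absolute Anabelian Geometry III*, Cor. 1.10 (i)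
  p. 41–42.
-/

noncomputable section

open CategoryTheory Function

universe u

namespace Literature.AnabelianGeometry.AbsoluteAnabelian

open Field
open Literature.NumberTheory.GaloisRepresentations
open Literature.NumberTheory.GaloisRepresentations.DiscreteGaloisModule

/-! ### The factorial chain `(i+1)!` in `ℕ+` -/

/-- The cofinal chain `cycLevel i = (i+1)!` of `ℕ+` (under divisibility), along which `μ_Ẑ = lim_n μ_n`
is computed: `cycLevel 0 = 1`, `cycLevel (i+1) = cycLevel i * (i+2)`.
[cite: MochizukiAbsTopIII2015, Cor 1.10 (i) p.41] -/
def cycLevel : ℕ → ℕ+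
  | 0 => 1
  | i + 1 => cycLevel i * ⟨i + 2, by omega⟩

/-- `cycLevel (i+1) = cycLevel i * (i+2)`. [cite: MochizukiAbsTopIII2015, Cor 1.10 (i) p.41] -/
theorem cycLevel_succ (i : ℕ) : cycLevel (i + 1) = cycLevel i * ⟨i + 2, by omega⟩ := rfl

/-- `cycLevel i = (i+1)!`. [cite: MochizukiAbsTopIII2015, Cor 1.10 (i) p.41] -/
theorem coe_cycLevel (i : ℕ) : (cycLevel i : ℕ) = (i + 1).factorial := by
  induction i with
  | zero => rfl
  | succ i ih => rw [cycLevel_succ, PNat.mul_coe, ih, Nat.factorial_succ (i + 1), mul_comm]; rfl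

/-- Every `n ≥ 1` divides `cycLevel (n - 1) = n!`. [cite: MochizukiAbsTopIII2015, Cor 1.10 (i) p.41] -/
theorem dvd_cycLevel_natPred (n : ℕ+) : (n : ℕ) ∣ (cycLevel n.natPred : ℕ) := by
  rw [coe_cycLevel, PNat.natPred_add_one]
  exact Nat.dvd_factorial n.pos le_rfl

/-- The chain is monotone for divisibility. [cite: MochizukiAbsTopIII2015, Cor 1.10 (i) p.41] -/
theorem cycLevel_dvd {i j : ℕ} (h : i ≤ j) : (cycLevel i : ℕ) ∣ (cycLevel j : ℕ) := by
  rw [coe_cycLevel, coe_cycLevel]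
  exact Nat.factorial_dvd_factorial (by omega)

/-! ### The power maps `μ_N(k̄) → μ_n(k̄)` -/

section MuPow

variable (k : Type u) [Field k]

/-- The power map `μ_N(k̄) → μ_n(k̄)`, `ζ ↦ ζ^d`, for `n * d = N`, on the carriers of the tree's
discrete Galois modules. [cite: MochizukiAbsTopIII2015, Cor 1.10 (i) p.41] -/
def muPow (N n d : ℕ) (h : n * d = N) : MuCarrier k N →+ MuCarrier k n where
  toFun v := MuCarrier.ofRootsOfUnity ⟨muVal k N v ^ d, by
    rw [mem_rootsOfUnity, ← pow_mul, mul_comm, h, muVal_pow_eq_one]⟩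
  map_zero' := muVal_injective k n (by simp)
  map_add' v w := muVal_injective k n (by simp [mul_pow])

/-- `muVal (muPow v) = (muVal v)^d`. [cite: MochizukiAbsTopIII2015, Cor 1.10 (i) p.41] -/
@[simp] theorem muVal_muPow {N n d : ℕ} (h : n * d = N) (v : MuCarrier k N) :
    muVal k n (muPow k N n d h v) = muVal k N v ^ d := rfl

/-- The power map `μ_N(k̄) → μ_n(k̄)` (`n * d = N`) as a morphism of the discrete Galois modules
(`Γ_k`-equivariant, continuous). [cite: MochizukiAbsTopIII2015, Cor 1.10 (i) p.41] -/
def muPowHom (N n d : ℕ) (h : n * d = N) : (mu k N).toTopRep ⟶ (mu k n).toTopRep :=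
  TopRep.ofHom ⟨⟨(muPow k N n d h).toIntLinearMap, continuous_of_discreteTopology⟩, fun σ => by
    ext v
    apply muVal_injective k n
    change muVal k n (muPow k N n d h (mu k N σ v)) = muVal k n (mu k n σ (muPow k N n d h v))
    rw [muVal_muPow, muVal_apply, muVal_apply, muVal_muPow, smul_pow']⟩

/-- `muPowHom` on elements. [cite: MochizukiAbsTopIII2015, Cor 1.10 (i) p.41] -/
@[simp] theorem muPowHom_hom_apply {N n d : ℕ} (h : n * d = N) (v : MuCarrier k N) :
    (muPowHom k N n d h).hom v = muPow k N n d h v := rfl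

/-- The power maps are **surjective** (`d ≥ 1`): `k̄` is algebraically closed, so every `n`-th root
of unity has a `d`-th root, which is an `N`-th root of unity.
[cite: MochizukiAbsTopIII2015, Cor 1.10 (i) p.41] -/
theorem muPow_surjective {N n d : ℕ} (h : n * d = N) (hd : 0 < d) :
    Surjective (muPow k N n d h) := by
  intro w
  obtain ⟨x, hx⟩ := IsAlgClosed.exists_pow_nat_eq ((muVal k n w : (AlgebraicClosure k)ˣ) :
    AlgebraicClosure k) hd
  have hx0 : x ≠ 0 := by
    rintro rfl
    rw [zero_pow hd.ne'] at hx
    exact (muVal k n w).ne_zero hx.symm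
  let u : (AlgebraicClosure k)ˣ := Units.mk0 x hx0
  have hu : u ^ d = muVal k n w := Units.ext (by simp [u, hx])
  have huN : u ^ N = 1 := by rw [← h, mul_comm, pow_mul, hu, muVal_pow_eq_one]
  refine ⟨MuCarrier.ofRootsOfUnity ⟨u, (mem_rootsOfUnity _ _).2 huN⟩, muVal_injective k n ?_⟩
  rw [muVal_muPow, muVal_ofRootsOfUnity]
  exact hu

end MuPow

/-! ### Extending a chain-compatible family of roots of unity to `μ_Ẑ(G_k)` -/

section Chain

variable {k : Type u} [Field k]

/-- A chain-compatible family: `s_{i+1}^{i+2} = s_i`. [cite: MochizukiAbsTopIII2015, Cor 1.10 (i) p.41] -/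
def IsChainCompatible (s : ∀ i, MuCarrier k (cycLevel i)) : Prop :=
  ∀ i, muVal k _ (s (i + 1)) ^ (i + 2) = muVal k _ (s i)

/-- Iterated compatibility: `s_j ^ ((j+1)!/(i+1)!) = s_i` for `i ≤ j`.
[cite: MochizukiAbsTopIII2015, Cor 1.10 (i) p.41] -/
theorem IsChainCompatible.pow_div {s : ∀ i, MuCarrier k (cycLevel i)} (hs : IsChainCompatible s)
    {i j : ℕ} (h : i ≤ j) :
    muVal k _ (s j) ^ ((cycLevel j : ℕ) / cycLevel i) = muVal k _ (s i) := by
  induction h with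
  | refl => rw [Nat.div_self (cycLevel i).pos, pow_one]
  | @step j hij ih =>
    have h1 : (cycLevel (j + 1) : ℕ) / cycLevel i = (j + 2) * ((cycLevel j : ℕ) / cycLevel i) := by
      rw [cycLevel_succ, PNat.mul_coe, PNat.mk_coe, mul_comm, Nat.mul_div_assoc _ (cycLevel_dvd hij)]
    rw [h1, pow_mul, hs j, ih]

/-- The would-be `n`-th component of the extension: `s_i ^ ((i+1)!/n)` for ANY `i` with `n ∣ (i+1)!`
does not depend on `i`. [cite: MochizukiAbsTopIII2015, Cor 1.10 (i) p.41] -/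
theorem IsChainCompatible.pow_div_eq_pow_div {s : ∀ i, MuCarrier k (cycLevel i)}
    (hs : IsChainCompatible s) {n : ℕ} {i j : ℕ} (hi : n ∣ (cycLevel i : ℕ))
    (hj : n ∣ (cycLevel j : ℕ)) :
    muVal k _ (s i) ^ ((cycLevel i : ℕ) / n) = muVal k _ (s j) ^ ((cycLevel j : ℕ) / n) := by
  wlog hij : i ≤ j generalizing i j
  · exact (this hj hi (le_of_not_ge hij)).symm
  obtain ⟨e, he⟩ := hi
  obtain ⟨f, hf⟩ := cycLevel_dvd hij
  have hn : 0 < n := Nat.pos_of_ne_zero (by rintro rfl; simp at he)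
  have hepos : 0 < e := Nat.pos_of_ne_zero (by rintro rfl; simp at he)
  rw [← hs.pow_div hij, ← pow_mul]
  congr 1
  rw [hf, he, Nat.mul_div_cancel_left f (Nat.mul_pos hn hepos), Nat.mul_div_cancel_left e hn,
    mul_assoc, Nat.mul_div_cancel_left (e * f) hn, mul_comm]

variable (s : ∀ i, MuCarrier k (cycLevel i)) (hs : IsChainCompatible s)

/-- The `n`-th unit of the extension: `u_n = s_{n-1} ^ (n!/n)`.
[cite: MochizukiAbsTopIII2015, Cor 1.10 (i) p.41] -/
def cycLiftUnit (n : ℕ+) : (AlgebraicClosure k)ˣ :=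
  muVal k _ (s n.natPred) ^ ((cycLevel n.natPred : ℕ) / n)

include hs in
/-- `u_n` computed at any admissible index. [cite: MochizukiAbsTopIII2015, Cor 1.10 (i) p.41] -/
theorem cycLiftUnit_eq (n : ℕ+) {i : ℕ} (hi : (n : ℕ) ∣ (cycLevel i : ℕ)) :
    cycLiftUnit s n = muVal k _ (s i) ^ ((cycLevel i : ℕ) / n) :=
  hs.pow_div_eq_pow_div (dvd_cycLevel_natPred n) hi

/-- `u_n ^ n = 1`. [cite: MochizukiAbsTopIII2015, Cor 1.10 (i) p.41] -/
theorem cycLiftUnit_pow (n : ℕ+) : cycLiftUnit s n ^ (n : ℕ) = 1 := by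
  rw [cycLiftUnit, ← pow_mul, Nat.div_mul_cancel (dvd_cycLevel_natPred n), muVal_pow_eq_one]

include hs in
/-- `u_{nm} ^ m = u_n`. [cite: MochizukiAbsTopIII2015, Cor 1.10 (i) p.41] -/
theorem cycLiftUnit_mul_pow (n m : ℕ+) : cycLiftUnit s (n * m) ^ (m : ℕ) = cycLiftUnit s n := by
  have hnm : ((n * m : ℕ+) : ℕ) ∣ (cycLevel (n * m).natPred : ℕ) := dvd_cycLevel_natPred _
  rw [PNat.mul_coe] at hnm
  have hn : (n : ℕ) ∣ (cycLevel (n * m).natPred : ℕ) := (dvd_mul_right (n : ℕ) m).trans hnm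
  rw [cycLiftUnit_eq s hs n hn, cycLiftUnit, ← pow_mul]
  congr 1
  obtain ⟨q, hq⟩ := hnm
  have h1 : (cycLevel (n * m).natPred : ℕ) / ((n * m : ℕ+) : ℕ) = q := by
    rw [PNat.mul_coe, hq, Nat.mul_div_cancel_left _ (Nat.mul_pos n.pos m.pos)]
  have h2 : (cycLevel (n * m).natPred : ℕ) / n = m * q := by
    rw [hq, mul_assoc, Nat.mul_div_cancel_left _ n.pos]
  rw [h1, h2, mul_comm]

/-- The torsion element `u_n ∈ (k̄ˣ)_tors`. [cite: MochizukiAbsTopIII2015, Cor 1.10 (i) p.41] -/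
def cycLiftTorsion (n : ℕ+) : CommGroup.torsion (AlgebraicClosure k)ˣ :=
  ⟨cycLiftUnit s n, (CommGroup.mem_torsion _).2
    (isOfFinOrder_iff_pow_eq_one.2 ⟨n, n.pos, cycLiftUnit_pow s n⟩)⟩

end Chain

end Literature.AnabelianGeometry.AbsoluteAnabelian

end
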